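import Literature.Probability.RandomPlanarGeometry.BrownianBridgeSplitting
import HarnessLib

/-!
# Splitting the planar unit bridge at a fixed time

Planar form of `BrownianBridgeSplitting` for the unit bridge `η = Z − (·) Z_1` of
`BrownianLoopMeasure` (Lawler, *Conformally Invariant Processes in the Plane* (2005), §5.2,
Chapman–Kolmogorov for the loop measures `μ(z, w; t)`, normalised Gaussian form): with
`A_v = η_{uv} − v η_u` and `C_v = η_{u+(1−u)v} − (1 − v) η_u`,

* `map_splitFstC`, `map_splitSndC` — `A` has the law of `√u η` and `C` the law of `√(1−u) η`
  on `[0,1] → ℂ`;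
* `indepFun_splitFstC`, `indepFun_splitSndC_unitBridge` — `A ⟂ (C, η_u)` and `C ⟂ η_u`.

The two coordinates of `η` are independent real unit bridges (`unitBridge_eq`), so everything is
the real statement twice (`indepFun_prodMap`, `map_prod_map`).

## References

* G. F. Lawler, *Conformally Invariant Processes in the Plane*, AMS (2005), §5.2.
* O. Kallenberg, *Foundations of Modern Probability* (2nd ed., 2002), Ch. 13, Lemma 13.1.
-/

noncomputable section

open Set MeasureTheory ProbabilityTheory unitInterval
open scoped unitInterval NNReal ENNReal

namespace Literature.Probability.RandomPlanarGeometry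

open Literature.Probability.Process (WienerPair wienerPair brownian measurable_brownian
  preWienerMeasure)

namespace BrownianLoop

variable (u : I)

/-- The planar first piece in terms of the real ones. [folklore] -/
theorem unitBridge_fstTime_sub (ω : WienerPair) (v : I) :
    unitBridge ω (fstTime u v) - (v : ℝ) • unitBridge ω u =
      (splitFst u ω.1 v : ℂ) + (splitFst u ω.2 v : ℂ) * Complex.I := by
  rw [unitBridge_eq, unitBridge_eq]
  simp only [splitFst, Complex.real_smul]
  push_cast
  ring

/-- The planar second piece in terms of the real ones. [folklore] -/
theorem unitBridge_sndTime_sub (ω : WienerPair) (v : I) :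
    unitBridge ω (sndTime u v) - (1 - (v : ℝ)) • unitBridge ω u =
      (splitSnd u ω.1 v : ℂ) + (splitSnd u ω.2 v : ℂ) * Complex.I := by
  rw [unitBridge_eq, unitBridge_eq]
  simp only [splitSnd, Complex.real_smul]
  push_cast
  ring

/-- Assembling a complex path from two real paths is measurable. [folklore] -/
theorem measurable_mkPath :
    Measurable fun q : (I → ℝ) × (I → ℝ) ↦ fun u : I ↦ (q.1 u : ℂ) + (q.2 u : ℂ) * Complex.I :=
  measurable_pi_lambda _ fun u ↦ (Complex.measurable_ofReal.comp
    ((measurable_pi_apply u).comp measurable_fst)).add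
    ((Complex.measurable_ofReal.comp ((measurable_pi_apply u).comp measurable_snd)).mul_const _)

/-- Transfer of an identity in law for real path functionals of the canonical Brownian motion to
the corresponding complex path functional of the pair. [folklore] -/
theorem map_mkPath_eq {X Y : (ℝ≥0 → ℝ) → I → ℝ} (hX : Measurable X) (hY : Measurable Y)
    (h : preWienerMeasure.map X = preWienerMeasure.map Y) :
    wienerPair.map (fun ω (v : I) ↦ (X ω.1 v : ℂ) + (X ω.2 v : ℂ) * Complex.I) =
      wienerPair.map (fun ω (v : I) ↦ (Y ω.1 v : ℂ) + (Y ω.2 v : ℂ) * Complex.I) := by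
  haveI := isProbabilityMeasure_preWienerMeasure'
  have e : ∀ Z : (ℝ≥0 → ℝ) → I → ℝ,
      (fun (ω : WienerPair) (v : I) ↦ (Z ω.1 v : ℂ) + (Z ω.2 v : ℂ) * Complex.I) =
        (fun q : (I → ℝ) × (I → ℝ) ↦ fun u : I ↦ (q.1 u : ℂ) + (q.2 u : ℂ) * Complex.I) ∘
          Prod.map Z Z := fun Z ↦ rfl
  rw [e X, e Y, ← Measure.map_map measurable_mkPath (hX.prodMap hX),
    ← Measure.map_map measurable_mkPath (hY.prodMap hY), Process.wienerPair,
    ← Measure.map_prod_map _ _ hX hX, ← Measure.map_prod_map _ _ hY hY, h]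

/-- **The planar first piece has the law of `√u · η`** on `[0,1] → ℂ`.
[cite: Lawler2005ConformallyInvariant, §5.2] -/
theorem map_splitFstC :
    wienerPair.map (fun ω (v : I) ↦ unitBridge ω (fstTime u v) - (v : ℝ) • unitBridge ω u) =
      wienerPair.map (fun ω (v : I) ↦ (Real.sqrt u : ℂ) * unitBridge ω v) := by
  have h := map_mkPath_eq (measurable_pi_lambda _ fun v ↦ measurable_splitFst u v)
    (measurable_pi_lambda _ fun v ↦ (measurable_bridge₁ v).const_mul (Real.sqrt u))
    (map_splitFst u)
  have e1 : (fun (ω : WienerPair) (v : I) ↦ unitBridge ω (fstTime u v) - (v : ℝ) • unitBridge ω u)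
      = fun ω v ↦ (splitFst u ω.1 v : ℂ) + (splitFst u ω.2 v : ℂ) * Complex.I := by
    funext ω v; exact unitBridge_fstTime_sub u ω v
  have e2 : (fun (ω : WienerPair) (v : I) ↦ (Real.sqrt u : ℂ) * unitBridge ω v) =
      fun ω v ↦ ((Real.sqrt u * bridge₁ ω.1 v : ℝ) : ℂ) +
        ((Real.sqrt u * bridge₁ ω.2 v : ℝ) : ℂ) * Complex.I := by
    funext ω v; rw [unitBridge_eq]; push_cast; ring
  rw [e1, e2, h]

/-- **The planar second piece has the law of `√(1−u) · η`** on `[0,1] → ℂ`.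
[cite: Lawler2005ConformallyInvariant, §5.2] -/
theorem map_splitSndC :
    wienerPair.map (fun ω (v : I) ↦ unitBridge ω (sndTime u v) - (1 - (v : ℝ)) • unitBridge ω u) =
      wienerPair.map (fun ω (v : I) ↦ (Real.sqrt (1 - u) : ℂ) * unitBridge ω v) := by
  have h := map_mkPath_eq (measurable_pi_lambda _ fun v ↦ measurable_splitSnd u v)
    (measurable_pi_lambda _ fun v ↦ (measurable_bridge₁ v).const_mul (Real.sqrt (1 - u)))
    (map_splitSnd u)
  have e1 : (fun (ω : WienerPair) (v : I) ↦
      unitBridge ω (sndTime u v) - (1 - (v : ℝ)) • unitBridge ω u) =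
      fun ω v ↦ (splitSnd u ω.1 v : ℂ) + (splitSnd u ω.2 v : ℂ) * Complex.I := by
    funext ω v; exact unitBridge_sndTime_sub u ω v
  have e2 : (fun (ω : WienerPair) (v : I) ↦ (Real.sqrt (1 - u) : ℂ) * unitBridge ω v) =
      fun ω v ↦ ((Real.sqrt (1 - u) * bridge₁ ω.1 v : ℝ) : ℂ) +
        ((Real.sqrt (1 - u) * bridge₁ ω.2 v : ℝ) : ℂ) * Complex.I := by
    funext ω v; rw [unitBridge_eq]; push_cast; ring
  rw [e1, e2, h]

/-- **The planar first piece is independent of (second piece, splitting value).**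
[cite: Lawler2005ConformallyInvariant, §5.2] -/
theorem indepFun_splitFstC :
    IndepFun (fun ω (v : I) ↦ unitBridge ω (fstTime u v) - (v : ℝ) • unitBridge ω u)
      (fun ω ↦ ((fun v : I ↦ unitBridge ω (sndTime u v) - (1 - (v : ℝ)) • unitBridge ω u),
        unitBridge ω u)) wienerPair := by
  haveI := isProbabilityMeasure_preWienerMeasure'
  -- real ingredients on one coordinate
  set fA : (ℝ≥0 → ℝ) → (I → ℝ) := fun ω₁ v ↦ splitFst u ω₁ v with hfA
  set gCM : (ℝ≥0 → ℝ) → (I ⊕ Unit → ℝ) := fun ω₁ p ↦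
    Sum.elim (fun v ↦ splitSnd u ω₁ v) (fun _ ↦ bridge₁ ω₁ u) p with hgCM
  have hfAm : Measurable fA := measurable_pi_lambda _ fun v ↦ measurable_splitFst u v
  have hgCMm : Measurable gCM := by
    refine measurable_pi_lambda _ ?_
    rintro (v | x)
    · exact measurable_splitSnd u v
    · exact measurable_bridge₁ u
  have h1 : IndepFun fA gCM preWienerMeasure := indepFun_splitFst_splitSnd_bridge₁ u
  have hpair := Process.indepFun_prodMap h1 h1 hfAm hgCMm hfAm hgCMm
  -- assemble the complex objects
  set F : (I → ℝ) × (I → ℝ) → (I → ℂ) := fun q v ↦ (q.1 v : ℂ) + (q.2 v : ℂ) * Complex.I with hF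
  set G : (I ⊕ Unit → ℝ) × (I ⊕ Unit → ℝ) → (I → ℂ) × ℂ := fun q ↦
    ((fun v ↦ (q.1 (Sum.inl v) : ℂ) + (q.2 (Sum.inl v) : ℂ) * Complex.I),
      (q.1 (Sum.inr ()) : ℂ) + (q.2 (Sum.inr ()) : ℂ) * Complex.I) with hG
  have hGm : Measurable G := by
    refine (measurable_pi_lambda _ fun v ↦ ?_).prodMk ?_
    · exact (Complex.measurable_ofReal.comp ((measurable_pi_apply _).comp measurable_fst)).add
        ((Complex.measurable_ofReal.comp ((measurable_pi_apply _).comp measurable_snd)).mul_const _)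
    · exact (Complex.measurable_ofReal.comp ((measurable_pi_apply _).comp measurable_fst)).add
        ((Complex.measurable_ofReal.comp ((measurable_pi_apply _).comp measurable_snd)).mul_const _)
  have e1 : (fun (ω : WienerPair) (v : I) ↦ unitBridge ω (fstTime u v) - (v : ℝ) • unitBridge ω u)
      = F ∘ Prod.map fA fA := by
    funext ω v; exact unitBridge_fstTime_sub u ω v
  have e2 : (fun (ω : WienerPair) ↦ ((fun v : I ↦ unitBridge ω (sndTime u v) -
      (1 - (v : ℝ)) • unitBridge ω u), unitBridge ω u)) = G ∘ Prod.map gCM gCM := by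
    funext ω
    refine Prod.ext (funext fun v ↦ ?_) ?_
    · exact unitBridge_sndTime_sub u ω v
    · change unitBridge ω u = (bridge₁ ω.1 u : ℂ) + (bridge₁ ω.2 u : ℂ) * Complex.I
      exact unitBridge_eq ω u
  rw [e1, e2, Process.wienerPair]
  exact hpair.comp measurable_mkPath hGm

/-- **The planar second piece is independent of the splitting value `η_u`.**
[cite: Lawler2005ConformallyInvariant, §5.2] -/
theorem indepFun_splitSndC_unitBridge :
    IndepFun (fun ω (v : I) ↦ unitBridge ω (sndTime u v) - (1 - (v : ℝ)) • unitBridge ω u)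
      (fun ω ↦ unitBridge ω u) wienerPair := by
  have h := indepFun_splitFstC u
  -- project the pair `(C, η_u)`: independence of `C` and `η_u` from the real statement
  haveI := isProbabilityMeasure_preWienerMeasure'
  set fC : (ℝ≥0 → ℝ) → (I → ℝ) := fun ω₁ v ↦ splitSnd u ω₁ v with hfC
  have hfCm : Measurable fC := measurable_pi_lambda _ fun v ↦ measurable_splitSnd u v
  have h1 : IndepFun fC (fun ω₁ ↦ bridge₁ ω₁ u) preWienerMeasure := indepFun_splitSnd_bridge₁ u
  have hpair := Process.indepFun_prodMap h1 h1 hfCm (measurable_bridge₁ u) hfCm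
    (measurable_bridge₁ u)
  set Gc : ℝ × ℝ → ℂ := fun q ↦ (q.1 : ℂ) + (q.2 : ℂ) * Complex.I with hGc
  have hGcm : Measurable Gc := (Complex.measurable_ofReal.comp measurable_fst).add
    ((Complex.measurable_ofReal.comp measurable_snd).mul_const _)
  have e1 : (fun (ω : WienerPair) (v : I) ↦
      unitBridge ω (sndTime u v) - (1 - (v : ℝ)) • unitBridge ω u) =
      (fun q : (I → ℝ) × (I → ℝ) ↦ fun u : I ↦ (q.1 u : ℂ) + (q.2 u : ℂ) * Complex.I) ∘
        Prod.map fC fC := by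
    funext ω v; exact unitBridge_sndTime_sub u ω v
  have e2 : (fun (ω : WienerPair) ↦ unitBridge ω u) =
      Gc ∘ Prod.map (fun ω₁ ↦ bridge₁ ω₁ u) (fun ω₁ ↦ bridge₁ ω₁ u) := by
    funext ω; exact unitBridge_eq ω u
  rw [e1, e2, Process.wienerPair]
  exact hpair.comp measurable_mkPath hGcm

end BrownianLoop

end Literature.Probability.RandomPlanarGeometry

end
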